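import Summits.SmoothPoincare4.SmoothPoincare4.Theorems.ConvexBisectionAcyclicBisectionExistsBeltReturnReflect
import Mathlib.Analysis.SpecialFunctions.Trigonometric.Arctan
import HarnessLib

/-!
# N1 ▸ `node_N1_move` ▸ (d) N1-mono ▸ piece (d9), brick J2-3: THE DISPLACEMENT LIFT OF THE LINEAR RETURN MAP
(wave 8, crux stmt-SmoothPoincare4-10508, line `modp-braid-orbits`, registered stub `stub_M2geo` (N1) ▸
`node_N1_move` ▸ sub-node (d) `helper_N1_beltMonodromy` ▸ piece (d9); registered sub-goal
`helper_linearBeltReturn_lift`; uses brick J2-1 `…BeltReturnReflect.lean`, complements brick J2-2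
`…BeltReturnLinear.lean`)

The return map of the LINEAR belt model `Q₀ (u, m) = ⟪M û, m⟫` (Kosinski gluing `(û, r • v) ↔ (v, r • û)`) along the
affine chart line `m' (r') = r' • A - η • C` (`η > 0`) of the base page `-η` at the core angle `v` is
`(v, m') ↦ (refl_{M m'} v, m')` (brick J2-2).  Here we read it the way the (d) statement reads its return map
`G (t, r') = (t + D, r'₁)`: as a CONTINUOUS LIFT `D : ℝ → ℝ` of the displacement of the core angle along the line,

    `toC (refl_{M (r' • A - η • C)} v) = toC v · e^{2πi D (r')}`,   `D (-∞) = 0`,   `D (+∞) = n`,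

where `n` is the winding number of the closed loop `s ↦ refl_{M (cos (πs) • A + sin (πs) • C)} v` (`= σ κ` by
`helper_linearBeltReturn_integer` of brick J2-2; `= if s then 1 else -1` by `linearBeltReturn_sign`).  Ingredients:
§1 the reparametrisation `s (r') = 1/2 + arctan (r'/η)/π ∈ (0, 1)` of the line by the half-turn
(`chartLine_eq_smul_halfTurn`, `halfTurnParam_*`); §2 the loop is continuous of constant norm `‖v‖` and closes at `v`
(`⟪M A, v⟫ = 0`); a logarithm on `[0, 1]` has constant real part, its imaginary part is `2π D`, and the limits come
from the endpoints (`wind_spec`).  Everything is proved; no named facts, no `sorry`.  References: R. E. Gompf,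
A. I. Stipsicz, *4-Manifolds and Kirby Calculus* (1999), §8.2 [GompfStipsicz1999]; W. Fulton, *Algebraic Topology:
A First Course* (1995), §3 [Fulton1995].
-/

noncomputable section

set_option linter.dupNamespace false

open scoped Manifold ContDiff Topology ComplexConjugate
open Set Function Complex Filter
open Literature.Topology.FourManifolds Literature.Topology.PlaneTopology

namespace Summit.SmoothPoincare4.SmoothPoincare4.Theorems.AcyclicBisectionExists.ModpBraidOrbits

/-! ## §1 The chart line and the half-turn -/

/-- **The chart line and the half-turn**: for `s ∈ (0, 1)` the point `r' • A - η • C` of the affine chart line at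
`r' = -η cot (πs)` is the NEGATIVE multiple `-(η / sin (πs))` of the half-turn vector `cos (πs) • A + sin (πs) • C`
(so both define the same reflection; `r'` increases from `-∞` to `+∞` as `s` goes from `0` to `1`). [folklore] -/
theorem chartLine_eq_smul_halfTurn (A C : EuclideanSpace ℝ (Fin 2)) {η s : ℝ} (hs : s ∈ Ioo (0 : ℝ) 1) :
    (-(η * Real.cos (Real.pi * s) / Real.sin (Real.pi * s))) • A - η • C =
      (-(η / Real.sin (Real.pi * s))) • (Real.cos (Real.pi * s) • A + Real.sin (Real.pi * s) • C) := by
  have hsin : Real.sin (Real.pi * s) ≠ 0 :=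
    (Real.sin_pos_of_pos_of_lt_pi (by nlinarith [Real.pi_pos, hs.1])
      (by nlinarith [Real.pi_pos, hs.2])).ne'
  have h1 : -(η * Real.cos (Real.pi * s) / Real.sin (Real.pi * s)) =
      -(η / Real.sin (Real.pi * s)) * Real.cos (Real.pi * s) := by ring
  have h2 : -(η / Real.sin (Real.pi * s)) * Real.sin (Real.pi * s) = -η := by
    rw [neg_mul, div_mul_cancel₀ _ hsin]
  rw [smul_add, smul_smul, smul_smul, h2, ← h1, sub_eq_add_neg, neg_smul η C]

/-- The half-turn parameter of the chart line: `s (r') = 1/2 + arctan (r'/η)/π` lies in `(0, 1)`. [folklore] -/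
theorem halfTurnParam_mem (η r : ℝ) : 1 / 2 + Real.arctan (r / η) / Real.pi ∈ Ioo (0 : ℝ) 1 := by
  have h1 := Real.neg_pi_div_two_lt_arctan (r / η)
  have h2 := Real.arctan_lt_pi_div_two (r / η)
  have hπ := Real.pi_pos
  constructor
  · have : -(1 / 2 : ℝ) < Real.arctan (r / η) / Real.pi := by
      rw [lt_div_iff₀ hπ]; linarith
    linarith
  · have : Real.arctan (r / η) / Real.pi < 1 / 2 := by
      rw [div_lt_iff₀ hπ]; linarith
    linarith

/-- At the half-turn parameter the cotangent recovers the line parameter: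
`-η cos (πs)/sin (πs) = r'` for `s = 1/2 + arctan (r'/η)/π`, `η ≠ 0`. [folklore] -/
theorem halfTurnParam_cot {η : ℝ} (hη : η ≠ 0) (r : ℝ) :
    -(η * Real.cos (Real.pi * (1 / 2 + Real.arctan (r / η) / Real.pi)) /
        Real.sin (Real.pi * (1 / 2 + Real.arctan (r / η) / Real.pi))) = r := by
  have e : Real.pi * (1 / 2 + Real.arctan (r / η) / Real.pi) = Real.arctan (r / η) + Real.pi / 2 := by
    field_simp
    ring
  rw [e, Real.cos_add_pi_div_two, Real.sin_add_pi_div_two, mul_neg, neg_div, neg_neg, mul_div_assoc,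
    ← Real.tan_eq_sin_div_cos, Real.tan_arctan, mul_div_cancel₀ _ hη]

/-- The half-turn parameter tends to `1` as `r' → +∞` (`η > 0`), within `[0, 1]`. [folklore] -/
theorem tendsto_halfTurnParam_atTop {η : ℝ} (hη : 0 < η) :
    Tendsto (fun r : ℝ => 1 / 2 + Real.arctan (r / η) / Real.pi) atTop (𝓝[Icc (0 : ℝ) 1] 1) := by
  refine tendsto_nhdsWithin_iff.2 ⟨?_, Eventually.of_forall fun r => Ioo_subset_Icc_self (halfTurnParam_mem η r)⟩
  have h : Tendsto (fun r : ℝ => Real.arctan (r / η)) atTop (𝓝 (Real.pi / 2)) :=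
    (Real.tendsto_arctan_atTop.mono_right nhdsWithin_le_nhds).comp (tendsto_id.atTop_div_const hη)
  have h2 := (tendsto_const_nhds (x := (1 / 2 : ℝ))).add (h.div_const Real.pi)
  convert h2 using 2
  field_simp
  ring

/-- The half-turn parameter tends to `0` as `r' → -∞` (`η > 0`), within `[0, 1]`. [folklore] -/
theorem tendsto_halfTurnParam_atBot {η : ℝ} (hη : 0 < η) :
    Tendsto (fun r : ℝ => 1 / 2 + Real.arctan (r / η) / Real.pi) atBot (𝓝[Icc (0 : ℝ) 1] 0) := by
  refine tendsto_nhdsWithin_iff.2 ⟨?_, Eventually.of_forall fun r => Ioo_subset_Icc_self (halfTurnParam_mem η r)⟩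
  have h : Tendsto (fun r : ℝ => Real.arctan (r / η)) atBot (𝓝 (-(Real.pi / 2))) :=
    (Real.tendsto_arctan_atBot.mono_right nhdsWithin_le_nhds).comp (tendsto_id.atBot_div_const hη)
  have h2 := (tendsto_const_nhds (x := (1 / 2 : ℝ))).add (h.div_const Real.pi)
  convert h2 using 2
  field_simp
  ring

/-! ## §2 The displacement lift -/

/-- **THE DISPLACEMENT LIFT OF THE LINEAR RETURN MAP** (piece (d9) on the linear model, lift form).  For the belt
matrix `M`, a chart frame `(A, C)` at the core angle `v ≠ 0` with `⟪M A, v⟫ = 0` (the direction `A` is tangent to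
the base page through `v`), `η > 0`, non-degenerate lines `M (cos (πs) • A + sin (πs) • C) ≠ 0`, and `n` the winding
number of the closed loop `s ↦ refl_{M (cos (πs) • A + sin (πs) • C)} v`: there is a continuous `D : ℝ → ℝ` with
`toC (refl_{M (r' • A - η • C)} v) = toC v · e^{2πi D (r')}` for all `r'` — the core angle of the image of the chart
point `(v, r')` under the return map of the linear model is `v` turned by `D (r')` full turns —, `D → 0` at `-∞` and
`D → n` at `+∞`: the return map is `(t, r') ↦ (t + D (r'), ·)` with total displacement `n` between the two sides.
[cite: GompfStipsicz1999, §8.2] -/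
theorem helper_linearBeltReturn_lift : ∀ (M : EuclideanSpace ℝ (Fin 2) →L[ℝ] EuclideanSpace ℝ (Fin 2)) (A C v : EuclideanSpace ℝ (Fin 2)) (η : ℝ) (n : ℤ), 0 < η → v ≠ 0 → inner ℝ (M A) v = 0 → (∀ s : ℝ, M (Real.cos (Real.pi * s) • A + Real.sin (Real.pi * s) • C) ≠ 0) → Literature.Topology.PlaneTopology.wind (fun s : ℝ => Literature.Topology.FourManifolds.toC (v - (2 * inner ℝ (M (Real.cos (Real.pi * s) • A + Real.sin (Real.pi * s) • C)) v / ‖M (Real.cos (Real.pi * s) • A + Real.sin (Real.pi * s) • C)‖ ^ 2) • M (Real.cos (Real.pi * s) • A + Real.sin (Real.pi * s) • C))) = n → ∃ D : ℝ → ℝ, Continuous D ∧ (∀ r : ℝ, Literature.Topology.FourManifolds.toC (v - (2 * inner ℝ (M (r • A - η • C)) v / ‖M (r • A - η • C)‖ ^ 2) • M (r • A - η • C)) = Literature.Topology.FourManifolds.toC v * Complex.exp (2 * Real.pi * Complex.I * (D r : ℂ))) ∧ Filter.Tendsto D Filter.atBot (nhds 0) ∧ Filter.Tendsto D Filter.atTop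 (nhds (n : ℝ)) := by
  intro M A C v η n hη hv hA hne hwind
  -- the closed loop of the half-turn: continuous, of constant norm `‖v‖`, closing at `v`
  set f : ℝ → ℂ := fun s : ℝ => toC (v - (2 * inner ℝ (M (Real.cos (Real.pi * s) • A + Real.sin (Real.pi * s) • C)) v /
    ‖M (Real.cos (Real.pi * s) • A + Real.sin (Real.pi * s) • C)‖ ^ 2) •
      M (Real.cos (Real.pi * s) • A + Real.sin (Real.pi * s) • C)) with hf
  have hwc : Continuous fun s : ℝ => M (Real.cos (Real.pi * s) • A + Real.sin (Real.pi * s) • C) := by fun_prop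
  have hcoef : Continuous fun s : ℝ =>
      2 * inner ℝ (M (Real.cos (Real.pi * s) • A + Real.sin (Real.pi * s) • C)) v /
        ‖M (Real.cos (Real.pi * s) • A + Real.sin (Real.pi * s) • C)‖ ^ 2 :=
    (continuous_const.mul (hwc.inner continuous_const)).div ((hwc.norm).pow 2) fun s =>
      pow_ne_zero _ (norm_ne_zero_iff.2 (hne s))
  have hfc : Continuous f := contDiff_toC.continuous.comp (continuous_const.sub (hcoef.smul hwc))
  have hfn : ∀ s, ‖f s‖ = ‖v‖ := fun s => by
    rw [hf]
    dsimp only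
    rw [norm_toC, norm_reflectLine (hne s)]
  have hfne : ∀ s, f s ≠ 0 := fun s => by
    rw [← norm_ne_zero_iff, hfn]; exact norm_ne_zero_iff.2 hv
  have hf0 : f 0 = toC v := by
    rw [hf]
    dsimp only
    rw [mul_zero, Real.cos_zero, Real.sin_zero, one_smul, zero_smul, add_zero, reflectLine_of_inner_eq_zero hA]
  have hf1 : f 1 = toC v := by
    rw [hf]
    dsimp only
    rw [mul_one, Real.cos_pi, Real.sin_pi, zero_smul, add_zero, map_smul, reflectLine_line (by norm_num),
      reflectLine_of_inner_eq_zero hA]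
  obtain ⟨l, hl, hle⟩ := hasLogOn_Icc (a := 0) (b := 1) hfc.continuousOn (fun s _ => hfne s)
  have hws := wind_spec hl hle (hf0.trans hf1.symm)
  rw [hwind] at hws
  -- the real part of the logarithm is constant
  have hre : ∀ s ∈ Icc (0 : ℝ) 1, (l s).re = Real.log ‖v‖ := fun s hs => by
    have h := congrArg (fun z : ℂ => ‖z‖) (hle s hs)
    simp only [Complex.norm_exp] at h
    rw [hfn] at h
    rw [← h, Real.log_exp]
  have him : ∀ s ∈ Icc (0 : ℝ) 1, l s - l 0 = (((l s).im - (l 0).im : ℝ) : ℂ) * I := fun s hs => by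
    apply Complex.ext
    · simp [hre s hs, hre 0 ⟨le_rfl, zero_le_one⟩]
    · simp
  -- the reparametrisation of the line by the half-turn
  obtain ⟨sOf, hsOf⟩ : ∃ g : ℝ → ℝ, g = fun r => 1 / 2 + Real.arctan (r / η) / Real.pi := ⟨_, rfl⟩
  have hsc : Continuous sOf := by
    rw [hsOf]; fun_prop
  have hm : ∀ r, sOf r ∈ Ioo (0 : ℝ) 1 := fun r => by rw [hsOf]; exact halfTurnParam_mem η r
  have hsm : ∀ r, sOf r ∈ Icc (0 : ℝ) 1 := fun r => Ioo_subset_Icc_self (hm r)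
  have hline : ∀ r : ℝ, v - (2 * inner ℝ (M (r • A - η • C)) v / ‖M (r • A - η • C)‖ ^ 2) • M (r • A - η • C) =
      v - (2 * inner ℝ (M (Real.cos (Real.pi * sOf r) • A + Real.sin (Real.pi * sOf r) • C)) v /
        ‖M (Real.cos (Real.pi * sOf r) • A + Real.sin (Real.pi * sOf r) • C)‖ ^ 2) •
          M (Real.cos (Real.pi * sOf r) • A + Real.sin (Real.pi * sOf r) • C) := by
    intro r
    have key := chartLine_eq_smul_halfTurn A C (η := η) (hm r)
    have hcot : -(η * Real.cos (Real.pi * sOf r) / Real.sin (Real.pi * sOf r)) = r := by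
      rw [hsOf]; exact halfTurnParam_cot hη.ne' r
    rw [hcot] at key
    have hsin : Real.sin (Real.pi * sOf r) ≠ 0 :=
      (Real.sin_pos_of_pos_of_lt_pi (mul_pos Real.pi_pos (hm r).1)
        (mul_lt_of_lt_one_right Real.pi_pos (hm r).2)).ne'
    have hc : -(η / Real.sin (Real.pi * sOf r)) ≠ 0 := neg_ne_zero.2 (div_ne_zero hη.ne' hsin)
    rw [key, map_smul, reflectLine_line hc]
  -- the lift
  refine ⟨fun r => ((l (sOf r)).im - (l 0).im) / (2 * Real.pi), ?_, ?_, ?_, ?_⟩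
  · have h1 : Continuous fun r => l (sOf r) := hl.comp_continuous hsc hsm
    exact ((Complex.continuous_im.comp h1).sub continuous_const).div_const _
  · intro r
    have e1 : toC (v - (2 * inner ℝ (M (r • A - η • C)) v / ‖M (r • A - η • C)‖ ^ 2) • M (r • A - η • C)) =
        f (sOf r) := by rw [hline r]
    have e2 : f (sOf r) = exp (l 0) * exp (l (sOf r) - l 0) := by
      rw [← Complex.exp_add, add_sub_cancel, hle _ (hsm r)]
    rw [e1, e2, hle 0 ⟨le_rfl, zero_le_one⟩, hf0, him _ (hsm r)]
    congr 1
    congr 1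
    push_cast
    field_simp
  · have h1 : Tendsto (fun r => l (sOf r)) atBot (𝓝 (l 0)) :=
      (hl 0 ⟨le_rfl, zero_le_one⟩).tendsto.comp (by rw [hsOf]; exact tendsto_halfTurnParam_atBot hη)
    have h2 := (((Complex.continuous_im.tendsto _).comp h1).sub_const (l 0).im).div_const (2 * Real.pi)
    simpa using h2
  · have h1 : Tendsto (fun r => l (sOf r)) atTop (𝓝 (l 1)) :=
      (hl 1 ⟨zero_le_one, le_rfl⟩).tendsto.comp (by rw [hsOf]; exact tendsto_halfTurnParam_atTop hη)
    have h2 := (((Complex.continuous_im.tendsto _).comp h1).sub_const (l 0).im).div_const (2 * Real.pi)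
    have e : ((l 1).im - (l 0).im) / (2 * Real.pi) = n := by
      have h3 : (((l 1).im - (l 0).im : ℝ) : ℂ) = (n : ℂ) * (2 * Real.pi) := by
        have h := (him 1 ⟨zero_le_one, le_rfl⟩).symm.trans hws
        have h' : (((l 1).im - (l 0).im : ℝ) : ℂ) * I = ((n : ℂ) * (2 * Real.pi)) * I := by rw [h]; ring
        exact mul_right_cancel₀ I_ne_zero h'
      have h4 : (l 1).im - (l 0).im = n * (2 * Real.pi) := by exact_mod_cast h3
      rw [h4, mul_div_assoc, div_self (by positivity), mul_one]
    rw [e] at h2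
    exact h2

end Summit.SmoothPoincare4.SmoothPoincare4.Theorems.AcyclicBisectionExists.ModpBraidOrbits

end
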